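import Literature.AnabelianGeometry.SemiGraphs.Prop44iGraphStepGenuine
import Literature.AnabelianGeometry.SemiGraphs.CoveringGraphPullbackSquareSmallStab
import Literature.AnabelianGeometry.SemiGraphs.CoveringGraphEstranged
import Literature.AnabelianGeometry.SemiGraphs.SpecialFibreTowerOfCoveringsFiniteEdges
import Literature.AnabelianGeometry.SemiGraphs.QuasiCoherentSmallStabCovering
import HarnessLib

/-!
# [SemiAnbd] Prop 4.4 (i) GENUINE at the profinite carriers, FIRST REDUCTION INCLUDED: over a finite covering with small
# stabilisers the base-changed arrow is locally trivial AND immersive (Rmk 4.2.1), so Thm 1.2 (ii) applies — the finite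
# étale TOWER `𝒢_{S_π} → 𝒢_{S₀} → K` along which every connected piece of the pull-back EMBEDS (proof-only)

Mochizuki, *Semi-graphs of anabelioids*, Publ. RIMS **42** (2006), §4 Prop 4.4 (i) p. 54 («There exists a finite étale covering
`K̃ → K` of `K` such that the induced morphism `H̃ → K̃` from any connected component `H̃` of the pull-back of this finite étale
covering to `H` is an embedding» — print's `K′`, `H′` written `K̃`, `H̃` throughout this file to avoid a clash with its primed
semi-graph and edge variables `B′`, `e′`), its proof p. 55 («Since `K` is quasi-coherent, it follows from Proposition 2.5, (i), that we
may reduce immediately to the case where the given morphism `H → K` is locally trivial.  Thus, we are reduced to a problem in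
graph theory … cf. Theorem 1.2»), Rmk 4.2.1 p. 52 («the “local injectivity” of branches follows, in light of the local
triviality assumption, from the total aloofness of the semi-graphs of anabelioids involved»), Def 4.1 (ii) p. 50 (an
*embedding* of semi-graphs of anabelioids = a locally trivial morphism whose underlying morphism of semi-graphs is an
embedding), Def 2.4 (iv) p. 26 (aloof), Rmk 2.4.1 p. 26 (kurims `paper:url-f33ace170ff4`; PRIMS render
`paper:doi-10-2977-prims-1166642064` p0061 l.23–45, p0062 l.1–2, p0058 l.44–47). [cite: MochizukiSemiAnbd2006, Prop 4.4 (i), p. 54]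

PROOF-ONLY (cell abc-iut, layer L3, seat abc-iut-f-161 gen 9, row «(2c-∘) = PROP 4.4 (i) ASSEMBLY», SHAPES
HOME/staging/f/f-161/g9/SHAPES-2c-COMP.md; no definition, no instance, no named fact).  Inputs BY NAME: the fibre square
`Hom.covPullbackSnd` (f-161 g8 FILE A/B), the small-stabiliser reduction `Hom.covPullbackSnd_isLocallyTrivial_of_stab_le`
(FILE E), the graph step `Hom.prop44i_graphStep` (FILE D, over THE TREE'S Thm 1.2 (ii) `SemiGraph.zariskiMainTheorem_baseChange_holds`),
the heredity of aloofness `CovObj.isTotallyAloof_coveringGraph` (Rmk 2.4.1, abc-iut-L3 `CoveringGraphEstranged`), and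
abc-iut-f-169's Prop 2.5 (i) in `B^cov` currency `Hom.exists_finite_covObj_stab_le_range` (`QuasiCoherentSmallStabCovering`).

* §1 **Rmk 4.2.1, local injectivity** — `Hom.isImmersion_base_of_isLocallyTrivial`: a LOCALLY TRIVIAL morphism of profinite
  presentations whose SOURCE is totally aloof has IMMERSIVE underlying morphism of semi-graphs.  (Two branches `b₁ ≠ b₂` at `v′`
  over one branch `β` would give `F_{v′}(Π_{b_i}) = g_i·Π_β·g_i⁻¹` by the 2-cells and the surjectivity of `F_{e_i}`
  (`Hom.map_branchSubgroup_eq_of_surjective`), hence `Π_{b₁} = γ·Π_{b₂}·γ⁻¹` for the `γ` with `F_{v′}(γ) = g₁g₂⁻¹` — relative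
  index `1`, against the clause «infinite index» of Def 2.4 (iv) for the edge of `b₁`.)  NO hypothesis on the target.
  A desk counterexample in the SHAPES memo shows that WITHOUT aloofness the base change of an immersive `ψ.base` along a
  covering with small stabilisers need not be immersive (and then no further base change makes components embed) — so this,
  not «immersions are inherited», is the mechanism of print's proof.
* §2 bookkeeping: the covering semi-graphs `𝔾'_{ψ^*S₀}`, `𝔾_{S₀}` are finite for finite `𝔾_H`, `𝔾_K`, `S₀`.
* §3 **`Hom.prop44i_of_smallStab`** — for `ψ : H → K` with `𝔾_H`, `𝔾_K` finite, `H` totally aloof, injective constituents, and a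
  FINITE `S₀ ∈ B^cov(K)` with SMALL STABILISERS ON THE IMAGE of `ψ` (FILE E's `hV`/`hE` verbatim = abc-iut-f-169's Prop 2.5 (i)
  output shape): the second projection `ψ₀ : 𝒢'_{ψ^*S₀} → 𝒢_{S₀}` is locally trivial with immersive base, and — for any family of
  2-cells `θ₀` of `ψ₀` — there is a finite graph-covering `π : B′ → 𝔾_{S₀}` (Thm 1.2 (ii)) such that, with `S_π ∈ B^cov(𝒢_{S₀})`
  finite and locally trivial, the arrow `ψ₀^*S_π → S_π` of covering semi-graphs `𝒢''_{ψ₀^*S_π} → 𝒢_{S_π}` is LOCALLY TRIVIAL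
  (the constituent half of «embedding», Def 4.1 (ii)), its source semi-graph is `𝔾'_{ψ^*S₀} ×_{𝔾_{S₀}} B′` (bijective point lift),
  and EVERY CONNECTED sub-semi-graph of `𝔾'_{ψ^*S₀} ×_{𝔾_{S₀}} B′` EMBEDS into `B′ ≅ 𝔾_{S_π}` (the graph half) — print's (i)
  along the finite étale TOWER `𝒢_{S_π} → 𝒢_{S₀} → K` (a finite étale covering of `K`: §2 p. 23, `B(𝒢′) = B(𝒢)_{𝒢′}` for a
  finite étale `𝒢′ → 𝒢` — a covering of a covering is a covering; realised as ONE `S ∈ B^cov(K)` in `CoveringGraphTowerIsoOver`).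
* §4 **`Hom.prop44i_of_isQuasiCoherent`** — the binder-free form: for `K` QUASI-COHERENT and `ψ` locally open (with the
  hypotheses above) such an `S₀` EXISTS (abc-iut-f-169's `Hom.exists_finite_covObj_stab_le_range`, print's «Since `K` is
  quasi-coherent, it follows from Proposition 2.5, (i) …»), finite, tempered, with nonempty fibres — so the whole printed
  proof of (i) runs at the profinite carriers: first reduction (Prop 2.5 (i)) + Rmk 4.2.1 + Thm 1.2 (ii).
WHAT IS NOT CLAIMED (displayed honestly): (a) the ONE-OBJECT presentation `K̃ = 𝒢_S` of the tower
by a single `S ∈ B^cov(K)` (`CovObj.pre S_π`, abc-iut-L3-d6's `coveringEquiv`) together with the pasting `ψ^*S ↔ ψ₀^*S_π`;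
(b) the transport of «embedding» from the pull-back semi-graph to the covering semi-graph `𝔾''_{ψ₀^*S_π}` (the point lift is
shown bijective on vertices and edges, as in FILE D); (c) the `Loc(𝔾, Γ)`/`SgA` dressing — in particular the hypotheses
«`𝔾_H`, `𝔾_K` finite, `H` totally aloof, `K` quasi-coherent, `ψ` locally open with injective constituents» are DISPLAYED here,
whereas print derives them from «finite objects of `Loc(𝔾, Γ)`» (Prop 4.3 (i)).  Nothing printed beyond Thm 1.2 (ii)
(a tree theorem) is used; no side taken on [IUTchIII] Cor. 3.12.
-/

noncomputable section

namespace Literature.AnabelianGeometry.SemiGraphs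

open CategoryTheory

universe u

namespace ProfiniteSemiGraph

variable {𝒢' 𝒢 : ProfiniteSemiGraph.{u}}

/-! ## §1. Rmk 4.2.1: a locally trivial morphism from a totally aloof semi-graph of anabelioids is immersive -/

/-- The branch subgroup `Π_b ⊆ Π_v` does not depend on how the branch is named (transport along an equality of branches).
[cite: MochizukiSemiAnbd2006, §2 p.23] -/
theorem branchSubgroup_congr {b c : 𝒢.graph.Branch} (hbc : b = c) {v : 𝒢.graph.Vertex}
    (hb : 𝒢.graph.abuts b = some v) (hc : 𝒢.graph.abuts c = some v) :
    𝒢.branchSubgroup b v hb = 𝒢.branchSubgroup c v hc := by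
  subst hbc
  rfl

/-- The re-indexed branch homomorphism `brHomAt` has range `Π_b`. [cite: MochizukiSemiAnbd2006, §2 p.23] -/
theorem range_brHomAt (b : 𝒢.graph.Branch) (v : 𝒢.graph.Vertex) (h : 𝒢.graph.abuts b = some v)
    (f : 𝒢.graph.Edge) (q : 𝒢.graph.edgeOf b = f) :
    (𝒢.brHomAt b v h f q).toMonoidHom.range = 𝒢.branchSubgroup b v h := by
  subst q
  rfl

namespace Hom

variable (F : Hom 𝒢' 𝒢)

/-- **The image of a branch subgroup under a morphism with surjective edge constituent**: for a branch `b′` of `e′` abutting to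
`v′`, if `F_{e′}` is onto then `F_{v′}(Π_{b′}) = g_{b′} · Π_{F b′} · g_{b′}⁻¹`, `g_{b′}` the chosen 2-cell of `F` at `b′`
(Rmk 2.4.2: `F_{v′} ∘ b′_* = Inn(g_{b′}) ∘ (F b′)_* ∘ F_{e′}`). [cite: MochizukiSemiAnbd2006, Rmk 2.4.2 p.26] -/
theorem map_branchSubgroup_eq_of_surjective (b' : 𝒢'.graph.Branch) (v' : 𝒢'.graph.Vertex)
    (h' : 𝒢'.graph.abuts b' = some v') (hsurj : Function.Surjective (F.hE (𝒢'.graph.edgeOf b'))) :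
    (𝒢'.branchSubgroup b' v' h').map (F.hV v').toMonoidHom =
      (𝒢.branchSubgroup (F.base.branchMap b') (F.base.vertexMap v') (F.base.abuts_branchMap b' v' h')).map
        (MulAut.conj (F.conjugator b' v' h')).toMonoidHom := by
  ext y
  constructor
  · rintro ⟨_, ⟨x, rfl⟩, rfl⟩
    refine ⟨F.brComp b' v' h' x, ?_, ?_⟩
    · rw [← range_brHomAt _ _ _ _ (F.base.edgeOf_branchMap b')]
      exact ⟨F.hE _ x, rfl⟩
    · rw [MulEquiv.coe_toMonoidHom, MulAut.conj_apply]
      exact F.conjugator_spec b' v' h' x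
  · rintro ⟨z, hz, rfl⟩
    rw [← range_brHomAt _ _ _ _ (F.base.edgeOf_branchMap b')] at hz
    obtain ⟨w, rfl⟩ := hz
    obtain ⟨x, rfl⟩ := hsurj w
    refine ⟨𝒢'.brHom b' v' h' x, ⟨x, rfl⟩, ?_⟩
    rw [MulEquiv.coe_toMonoidHom, MulAut.conj_apply]
    exact (F.conjugator_spec b' v' h' x).symm

/-- Conjugation after a homomorphism is the homomorphism after conjugation by a preimage: `Inn(F γ) ∘ F = F ∘ Inn(γ)`.
[cite: MochizukiSemiAnbd2006, Rmk 2.4.2 p.26] -/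
theorem conj_comp_hV (v' : 𝒢'.graph.Vertex) (γ : 𝒢'.Gv v') :
    (MulAut.conj (F.hV v' γ)).toMonoidHom.comp (F.hV v').toMonoidHom =
      (F.hV v').toMonoidHom.comp (MulAut.conj γ).toMonoidHom := by
  ext x
  simp [MulAut.conj_apply, map_mul, map_inv]

/-- **Rmk 4.2.1 («the “local injectivity” of branches follows, in light of the local triviality assumption, from the total
aloofness»)**: a LOCALLY TRIVIAL morphism of semi-graphs of anabelioids (profinite presentation) whose source is TOTALLY ALOOF
has IMMERSIVE underlying morphism of semi-graphs.  Two distinct branches `b₁ ≠ b₂` at `v′` over the same branch would have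
`Π_{b₁} = γ Π_{b₂} γ⁻¹` in `Π_{v′}` (the constituents being isomorphisms), of relative index `1` — excluded by Def 2.4 (iv).
No hypothesis on the target. [cite: MochizukiSemiAnbd2006, Rmk 4.2.1, p. 52] -/
theorem isImmersion_base_of_isLocallyTrivial (hF : F.IsLocallyTrivial) (hA : 𝒢'.IsTotallyAloof) :
    SemiGraph.IsImmersion F.base := by
  intro v' b₁ b₂ h12
  have hβ : F.base.branchMap b₁.1 = F.base.branchMap b₂.1 := congrArg Subtype.val h12
  by_contra hne
  have hne' : b₂.1 ≠ b₁.1 := fun h => hne (Subtype.ext h.symm)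
  have h1 := F.map_branchSubgroup_eq_of_surjective b₁.1 v' b₁.2 (hF.2 _).2
  have h2 := F.map_branchSubgroup_eq_of_surjective b₂.1 v' b₂.2 (hF.2 _).2
  rw [← branchSubgroup_congr hβ (F.base.abuts_branchMap _ _ b₁.2) (F.base.abuts_branchMap _ _ b₂.2)] at h2
  -- `γ ∈ Π_{v′}` with `F_{v′}(γ) = g₁ g₂⁻¹`
  obtain ⟨γ, hγ⟩ := (hF.1 v').2 (F.conjugator b₁.1 v' b₁.2 * (F.conjugator b₂.1 v' b₂.2)⁻¹)
  -- `F_{v′}(Π_{b₁}) = F_{v′}(γ Π_{b₂} γ⁻¹)`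
  have key : (𝒢'.branchSubgroup b₁.1 v' b₁.2).map (F.hV v').toMonoidHom =
      ((𝒢'.branchSubgroup b₂.1 v' b₂.2).map (MulAut.conj γ).toMonoidHom).map (F.hV v').toMonoidHom := by
    rw [Subgroup.map_map, ← conj_comp_hV, ← Subgroup.map_map, h2, hγ, h1, Subgroup.map_map]
    congr 1
    ext x
    simp [MulAut.conj_apply, mul_assoc]
  have hconj : (𝒢'.branchSubgroup b₂.1 v' b₂.2).map (MulAut.conj γ).toMonoidHom = 𝒢'.branchSubgroup b₁.1 v' b₁.2 :=
    (Subgroup.map_injective (hF.1 v').1 key).symm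
  -- aloofness of the edge of `b₁` at `v′`, tested against `b₂ ≠ b₁` and `γ`
  have h0 := hA (𝒢'.graph.edgeOf b₁.1) b₁.1 rfl v' b₁.2 b₂.1 b₂.2 γ (Or.inl hne')
  rw [hconj, Subgroup.relIndex_self] at h0
  exact one_ne_zero h0

end Hom

/-! ## §2. Finiteness of the covering semi-graphs involved -/

namespace CovObj

/-- The covering semi-graph `𝔾_S` of a FINITE `S ∈ B^cov(G)` over a finite `𝔾` is finite. [cite: MochizukiSemiAnbd2006, Def 3.5(i) p.37] -/
theorem coveringGraph_graph_isFinite (S : CovObj 𝒢) (h𝒢 : 𝒢.graph.IsFinite) (hS : S.IsFinite) :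
    S.coveringGraph.graph.IsFinite := by
  haveI := h𝒢.finite_vertex
  haveI := h𝒢.finite_edge
  exact ⟨S.finite_vertex_coveringGraph hS, S.finite_edge_coveringGraph hS⟩

end CovObj

/-! ## §3. Prop 4.4 (i) along the tower `𝒢_{S_π} → 𝒢_{S₀} → K` -/

namespace Hom

variable {H K : ProfiniteSemiGraph.{u}} (ψ : Hom H K) (θ : ψ.ConjugatorFamily) (S₀ : CovObj K)

/-- **The first reduction, with immersivity**: if `H` is totally aloof, `ψ` has injective constituents and `S₀` has SMALL
STABILISERS ON THE IMAGE of `ψ`, then the second projection `ψ₀ : 𝒢'_{ψ^*S₀} → 𝒢_{S₀}` of the fibre square is locally trivial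
(FILE E) with IMMERSIVE underlying morphism of semi-graphs (§1 over Rmk 2.4.1: `𝒢'_{ψ^*S₀}` is totally aloof).
[cite: MochizukiSemiAnbd2006, Prop 4.4 (i), p. 54] -/
theorem covPullbackSnd_isLocallyTrivial_and_isImmersion (hHa : H.IsTotallyAloof)
    (hinjV : ∀ w, Function.Injective (ψ.hV w)) (hinjE : ∀ e', Function.Injective (ψ.hE e'))
    (hV : ∀ (w : H.graph.Vertex) (t : (S₀.SV (ψ.base.vertexMap w)).obj.V) (k : K.Gv (ψ.base.vertexMap w)),
      (S₀.SV _).obj.ρ k t = t → ∃ m : H.Gv w, ψ.hV w m = k)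
    (hE : ∀ (e' : H.graph.Edge) (t : (S₀.SE (ψ.base.edgeMap e')).obj.V) (k : K.Ge (ψ.base.edgeMap e')),
      (S₀.SE _).obj.ρ k t = t → ∃ m : H.Ge e', ψ.hE e' m = k) :
    (ψ.covPullbackSnd θ S₀).IsLocallyTrivial ∧ SemiGraph.IsImmersion (ψ.covPullbackSnd θ S₀).base :=
  have hlt := ψ.covPullbackSnd_isLocallyTrivial_of_stab_le θ S₀ hinjV hinjE hV hE
  ⟨hlt, (ψ.covPullbackSnd θ S₀).isImmersion_base_of_isLocallyTrivial hlt
    (((ψ.covPullbackWith θ).obj S₀).isTotallyAloof_coveringGraph hHa)⟩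

/-- **Prop 4.4 (i), GENUINE at the profinite carriers, first reduction included (tower form).**  Let `ψ : H → K` have finite
underlying semi-graphs `𝔾_H`, `𝔾_K`, totally aloof source, injective constituents, and let `S₀ ∈ B^cov(K)` be FINITE with SMALL
STABILISERS ON THE IMAGE of `ψ` (every point of `S₀` over `ψ w` / `ψ e′` has `Π_K`-stabiliser inside the image of the
corresponding constituent — the output shape of Prop 2.5 (i)).  Then the second projection `ψ₀ : 𝒢'_{ψ^*S₀} → 𝒢_{S₀}` is
«locally trivial» with immersive base, and for every family of 2-cells `θ₀` of `ψ₀` there are a FINITE semi-graph `B′` and a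
finite graph-covering `π : B′ → 𝔾_{S₀}` (Thm 1.2 (ii)) such that — with `S_π ∈ B^cov(𝒢_{S₀})` finite and locally trivial
(`𝔾_{S_π} ≅ B′`) and its pull-back `ψ₀^*S_π` locally trivial with covering semi-graph `𝔾'_{ψ^*S₀} ×_{𝔾_{S₀}} B′` (bijective point
lift) — the arrow `𝒢''_{ψ₀^*S_π} → 𝒢_{S_π}` is LOCALLY TRIVIAL and EVERY CONNECTED sub-semi-graph of `𝔾'_{ψ^*S₀} ×_{𝔾_{S₀}} B′`
EMBEDS into `B′` through the second projection: both halves of «embedding» (Def 4.1 (ii)) for the components of the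
pull-back of the finite étale tower `𝒢_{S_π} → 𝒢_{S₀} → K` to `H`.  Displayed scope: `S₀` is a hypothesis (its existence
for quasi-coherent `K` is Prop 2.5 (i)); the tower is not repackaged as one object of `B^cov(K)`.
[cite: MochizukiSemiAnbd2006, Prop 4.4 (i), p. 54] -/
theorem prop44i_of_smallStab (hH : H.graph.IsFinite) (hK : K.graph.IsFinite) (hHa : H.IsTotallyAloof)
    (hinjV : ∀ w, Function.Injective (ψ.hV w)) (hinjE : ∀ e', Function.Injective (ψ.hE e'))
    (hS₀ : S₀.IsFinite)
    (hV : ∀ (w : H.graph.Vertex) (t : (S₀.SV (ψ.base.vertexMap w)).obj.V) (k : K.Gv (ψ.base.vertexMap w)),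
      (S₀.SV _).obj.ρ k t = t → ∃ m : H.Gv w, ψ.hV w m = k)
    (hE : ∀ (e' : H.graph.Edge) (t : (S₀.SE (ψ.base.edgeMap e')).obj.V) (k : K.Ge (ψ.base.edgeMap e')),
      (S₀.SE _).obj.ρ k t = t → ∃ m : H.Ge e', ψ.hE e' m = k)
    (θ₀ : (ψ.covPullbackSnd θ S₀).ConjugatorFamily) :
    (ψ.covPullbackSnd θ S₀).IsLocallyTrivial ∧ SemiGraph.IsImmersion (ψ.covPullbackSnd θ S₀).base ∧
    ∃ (B' : SemiGraph.{u}) (π : B' ⟶ S₀.coveringGraph.graph) (hπ : SemiGraph.IsExcision π) (hp : SemiGraph.IsProper π)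
      (_ : ∀ v, Countable (SemiGraph.Hom.VertexFiber π v)) (_ : ∀ e, Countable (SemiGraph.Hom.EdgeFiber π e)),
      B'.IsFinite ∧ SemiGraph.IsFiniteGraphCovering π ∧
      (CovObj.ofSemiGraphCovering π hπ hp).IsFinite ∧ (CovObj.ofSemiGraphCovering π hπ hp).IsLocallyTrivial ∧
      (((ψ.covPullbackSnd θ S₀).covPullbackWith θ₀).obj (CovObj.ofSemiGraphCovering π hπ hp)).IsLocallyTrivial ∧
      ((ψ.covPullbackSnd θ S₀).covPullbackSnd θ₀ (CovObj.ofSemiGraphCovering π hπ hp)).IsLocallyTrivial ∧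
      Function.Bijective ((((ψ.covPullbackSnd θ S₀).covPullbackWith θ₀).obj (CovObj.ofSemiGraphCovering π hπ hp)).pointLift
        (SemiGraph.pullback.fst (ψ.covPullbackSnd θ S₀).base π) _ _
        ((ψ.covPullbackSnd θ S₀).pullback_glueCondition θ₀ π hπ hp)).vertexMap ∧
      Function.Bijective ((((ψ.covPullbackSnd θ S₀).covPullbackWith θ₀).obj (CovObj.ofSemiGraphCovering π hπ hp)).pointLift
        (SemiGraph.pullback.fst (ψ.covPullbackSnd θ S₀).base π) _ _
        ((ψ.covPullbackSnd θ S₀).pullback_glueCondition θ₀ π hπ hp)).edgeMap ∧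
      ∀ C : (SemiGraph.pullback (ψ.covPullbackSnd θ S₀).base π).Subgraph, C.toSemiGraph.IsConnected →
        SemiGraph.IsEmbedding (C.ι ≫ SemiGraph.pullback.snd (ψ.covPullbackSnd θ S₀).base π) := by
  obtain ⟨hlt, himm⟩ := ψ.covPullbackSnd_isLocallyTrivial_and_isImmersion θ S₀ hHa hinjV hinjE hV hE
  have hH' : ((ψ.covPullbackWith θ).obj S₀).coveringGraph.graph.IsFinite :=
    ((ψ.covPullbackWith θ).obj S₀).coveringGraph_graph_isFinite hH (ψ.isFinite_covPullbackWith θ hS₀)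
  have hK' : S₀.coveringGraph.graph.IsFinite := S₀.coveringGraph_graph_isFinite hK hS₀
  obtain ⟨B', π, hπ, hp, hcV, hcE, hB', hfgc, hfin, hlt₁, hlt₂, hbijV, hbijE, hemb⟩ :=
    (ψ.covPullbackSnd θ S₀).prop44i_graphStep θ₀ hH' hK' himm
  exact ⟨hlt, himm, B', π, hπ, hp, hcV, hcE, hB', hfgc, hfin, hlt₁, hlt₂,
    (ψ.covPullbackSnd θ S₀).covPullbackSnd_isLocallyTrivial θ₀ (CovObj.ofSemiGraphCovering π hπ hp) hlt,
    hbijV, hbijE, hemb⟩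

/-! ## §4. The binder-free form over a quasi-coherent `K` (Prop 2.5 (i) supplied by abc-iut-f-169) -/

/-- **Prop 4.4 (i), GENUINE at the profinite carriers, binder-free in the first reduction.**  For `ψ : H → K` with `𝔾_H`, `𝔾_K`
finite, `H` totally aloof, `K` QUASI-COHERENT and `ψ` locally open with injective constituents («locally finite étale»): there
is a FINITE tempered `S₀ ∈ B^cov(K)` with nonempty fibres (print: «Since `K` is quasi-coherent, it follows from Proposition 2.5,
(i), that we may reduce immediately to the case where the given morphism `H → K` is locally trivial» — abc-iut-f-169's
`Hom.exists_finite_covObj_stab_le_range`) over which the conclusion of `prop44i_of_smallStab` holds: `ψ₀ : 𝒢'_{ψ^*S₀} → 𝒢_{S₀}`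
locally trivial with immersive base (Rmk 4.2.1), and for every family of 2-cells `θ₀` a finite graph-covering `π : B′ → 𝔾_{S₀}`
(Thm 1.2 (ii)) with `𝒢''_{ψ₀^*S_π} → 𝒢_{S_π}` LOCALLY TRIVIAL and every connected piece of `𝔾'_{ψ^*S₀} ×_{𝔾_{S₀}} B′` EMBEDDING
into `B′` — the printed proof of (i), all three steps, along the finite étale tower `𝒢_{S_π} → 𝒢_{S₀} → K`.  Displayed scope as
in the module docstring (tower not repackaged as one object of `B^cov(K)`; no `Loc` dressing).
[cite: MochizukiSemiAnbd2006, Prop 4.4 (i), p. 54] -/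
theorem prop44i_of_isQuasiCoherent (hH : H.graph.IsFinite) (hK : K.graph.IsFinite) (hHa : H.IsTotallyAloof)
    (hqc : K.IsQuasiCoherent) (hψ : ψ.IsLocallyOpen)
    (hinjV : ∀ w, Function.Injective (ψ.hV w)) (hinjE : ∀ e', Function.Injective (ψ.hE e')) :
    ∃ S₀ : CovObj K, S₀.IsFinite ∧ S₀.HasNonemptyFibres ∧ S₀.IsTempered ∧
      (ψ.covPullbackSnd θ S₀).IsLocallyTrivial ∧ SemiGraph.IsImmersion (ψ.covPullbackSnd θ S₀).base ∧
      ∀ θ₀ : (ψ.covPullbackSnd θ S₀).ConjugatorFamily,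
      ∃ (B' : SemiGraph.{u}) (π : B' ⟶ S₀.coveringGraph.graph) (hπ : SemiGraph.IsExcision π) (hp : SemiGraph.IsProper π)
        (_ : ∀ v, Countable (SemiGraph.Hom.VertexFiber π v)) (_ : ∀ e, Countable (SemiGraph.Hom.EdgeFiber π e)),
        B'.IsFinite ∧ SemiGraph.IsFiniteGraphCovering π ∧
        (CovObj.ofSemiGraphCovering π hπ hp).IsFinite ∧ (CovObj.ofSemiGraphCovering π hπ hp).IsLocallyTrivial ∧
        (((ψ.covPullbackSnd θ S₀).covPullbackWith θ₀).obj (CovObj.ofSemiGraphCovering π hπ hp)).IsLocallyTrivial ∧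
        ((ψ.covPullbackSnd θ S₀).covPullbackSnd θ₀ (CovObj.ofSemiGraphCovering π hπ hp)).IsLocallyTrivial ∧
        Function.Bijective ((((ψ.covPullbackSnd θ S₀).covPullbackWith θ₀).obj (CovObj.ofSemiGraphCovering π hπ hp)).pointLift
          (SemiGraph.pullback.fst (ψ.covPullbackSnd θ S₀).base π) _ _
          ((ψ.covPullbackSnd θ S₀).pullback_glueCondition θ₀ π hπ hp)).vertexMap ∧
        Function.Bijective ((((ψ.covPullbackSnd θ S₀).covPullbackWith θ₀).obj (CovObj.ofSemiGraphCovering π hπ hp)).pointLift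
          (SemiGraph.pullback.fst (ψ.covPullbackSnd θ S₀).base π) _ _
          ((ψ.covPullbackSnd θ S₀).pullback_glueCondition θ₀ π hπ hp)).edgeMap ∧
        ∀ C : (SemiGraph.pullback (ψ.covPullbackSnd θ S₀).base π).Subgraph, C.toSemiGraph.IsConnected →
          SemiGraph.IsEmbedding (C.ι ≫ SemiGraph.pullback.snd (ψ.covPullbackSnd θ S₀).base π) := by
  haveI := hH.finite_vertex
  haveI := hH.finite_edge
  obtain ⟨S₀, hfin, hne, htemp, hV, hE⟩ := ψ.exists_finite_covObj_stab_le_range hqc hψ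
  obtain ⟨hlt, himm⟩ := ψ.covPullbackSnd_isLocallyTrivial_and_isImmersion θ S₀ hHa hinjV hinjE hV hE
  exact ⟨S₀, hfin, hne, htemp, hlt, himm, fun θ₀ =>
    (ψ.prop44i_of_smallStab θ S₀ hH hK hHa hinjV hinjE hfin hV hE θ₀).2.2⟩

end Hom

end ProfiniteSemiGraph

end Literature.AnabelianGeometry.SemiGraphs

end
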